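import Summits.QuantumFields.QCD.Theorems.SpectralDefectExtinctionWindowExtinctionSpreadTelescope
import Summits.QuantumFields.QCD.Theorems.SpectralDefectExtinctionWindowExtinctionSpreadPattern
import Mathlib.MeasureTheory.Integral.Marginal
import Mathlib.MeasureTheory.Integral.Bochner.Set

/-!
# The fibre atom bound from small mixed differences and bounded one-coordinate oscillation

Helper for stub `stub_spreadFromPartsR3` (S6′, reshape r3) of line `free-volume-heavy-witness`
(crux `Summit.QuantumFields.QCD.Theses.SpectralDefectExtinction.WindowExtinction`,
item stmt-QuantumFields-8964).  Pure measure theory, no project vocabulary.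

`spreadR3_fiber_atom_le`: on the finite product `I → T` with the product `ν^{⊗I}` of a probability
measure and two disjoint measurable classes `Tp`, `Tm` of positive `ν`-measure, let `φ` be a measurable
log-weight whose mixed second differences (two distinct coordinates, any base point) are `≤ γ` and whose
one-coordinate oscillation is `≤ B'`, and let `X` be a measurable integer statistic that increases by at
least one under every single `Tm → Tp` refill of a coordinate (all coordinates active).  Then, GIVEN the
fibre anti-concentration theorem in monotone form (stub S4″ `stub_fiberAtomMonotone`, taken here as a
hypothesis in its literal form) and the weighted antichain bound at the odds floor
`ε ≤ e^{-2B'} min(ν Tp, ν Tm)` with constant `C`, every atom of `X` carries at most the fraction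
`e^{2|I|²γ} C/√(|I|+1)` of the active mass.

Proof: telescoping (`spread_telescope_abs_le`) turns the mixed-difference bound into the `e^{±τ}`
product approximation with `τ = |I|² γ`, `a = φ t₀`, `bᵢ(u) = φ(t₀[i ↦ u]) − φ t₀`; the oscillation bound
gives the odds of `Tp` against `Tp ∪ Tm` under `e^{bᵢ} ν` in `[ε, 1 − ε]` (`spread_ratio_bounds`).
-/

noncomputable section

namespace Summit.QuantumFields.QCD.Cruxes.WindowExtinction.FreeVolumeHeavyWitness

open MeasureTheory Set Function
open scoped ENNReal BigOperators Classical

/-- **Odds of one coordinate.** If `b` oscillates by at most `B'` (everywhere) then under the tilted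
measure `e^{b} ν` the odds of `Tp` against the disjoint union `Tp ∪ Tm` lie in `[ε, 1 − ε]` as soon as
`ε ≤ e^{-2B'} min(ν Tp, ν Tm)` (probability measure `ν`, `ν Tp ≠ 0`). -/
theorem spreadR3_odds_of_osc {T : Type*} [MeasurableSpace T] (ν : Measure T) [IsProbabilityMeasure ν]
    {Tp Tm : Set T} (hTp : MeasurableSet Tp) (hTm : MeasurableSet Tm) (hdisj : Disjoint Tp Tm)
    (hTp0 : ν Tp ≠ 0) {b : T → ℝ} (hbm : Measurable b) {B' ε : ℝ}
    (hosc : ∀ u u', b u ≤ b u' + B')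
    (hε : ε ≤ Real.exp (-2 * B') * min (ν Tp).toReal (ν Tm).toReal) :
    ε * ∫ u in Tp ∪ Tm, Real.exp (b u) ∂ν ≤ ∫ u in Tp, Real.exp (b u) ∂ν ∧
      ∫ u in Tp, Real.exp (b u) ∂ν ≤ (1 - ε) * ∫ u in Tp ∪ Tm, Real.exp (b u) ∂ν := by
  obtain ⟨u₀, hu₀⟩ : Tp.Nonempty := nonempty_of_measure_ne_zero hTp0
  set b₀ := b u₀ with hb₀
  -- pointwise bounds on the tilt
  have hlo : ∀ u, Real.exp (b₀ - B') ≤ Real.exp (b u) := fun u =>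
    Real.exp_le_exp.2 (by linarith [hosc u₀ u])
  have hhi : ∀ u, Real.exp (b u) ≤ Real.exp (b₀ + B') := fun u =>
    Real.exp_le_exp.2 (by linarith [hosc u u₀])
  have hint : ∀ s : Set T, IntegrableOn (fun u => Real.exp (b u)) s ν := fun s =>
    (Integrable.of_bound hbm.exp.aestronglyMeasurable (Real.exp (b₀ + B'))
      (Filter.Eventually.of_forall fun u => by
        rw [Real.norm_eq_abs, abs_of_nonneg (Real.exp_pos _).le]; exact hhi u)).integrableOn
  -- the two partial masses
  set GT := ∫ u in Tp, Real.exp (b u) ∂ν with hGT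
  set GF := ∫ u in Tm, Real.exp (b u) ∂ν with hGF
  have hunion : ∫ u in Tp ∪ Tm, Real.exp (b u) ∂ν = GT + GF :=
    setIntegral_union hdisj hTm (hint Tp) (hint Tm)
  have hGT₁ : Real.exp (b₀ - B') * ν.real Tp ≤ GT := by
    have := setIntegral_ge_of_const_le (c := Real.exp (b₀ - B')) hTp (measure_ne_top ν Tp)
      (fun u _ => hlo u) (hint Tp)
    rwa [smul_eq_mul, mul_comm] at this
  have hGT₂ : GT ≤ Real.exp (b₀ + B') * ν.real Tp := by
    have := setIntegral_mono_on (hint Tp) (integrableOn_const (measure_ne_top ν Tp)) hTp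
      (fun u _ => hhi u)
    rwa [setIntegral_const, smul_eq_mul, mul_comm] at this
  have hGF₁ : Real.exp (b₀ - B') * ν.real Tm ≤ GF := by
    have := setIntegral_ge_of_const_le (c := Real.exp (b₀ - B')) hTm (measure_ne_top ν Tm)
      (fun u _ => hlo u) (hint Tm)
    rwa [smul_eq_mul, mul_comm] at this
  have hGF₂ : GF ≤ Real.exp (b₀ + B') * ν.real Tm := by
    have := setIntegral_mono_on (hint Tm) (integrableOn_const (measure_ne_top ν Tm)) hTm
      (fun u _ => hhi u)
    rwa [setIntegral_const, smul_eq_mul, mul_comm] at this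
  have hmp : 0 < ν.real Tp :=
    lt_of_le_of_ne measureReal_nonneg
      (Ne.symm ((measureReal_ne_zero_iff (measure_ne_top ν Tp)).2 hTp0))
  have hmm : 0 ≤ ν.real Tm := measureReal_nonneg
  have hmpm : ν.real Tp + ν.real Tm ≤ 1 := by
    rw [← measureReal_union hdisj hTm]
    exact measureReal_le_one
  obtain ⟨h1, h2⟩ := spread_ratio_bounds (B := B') (b₀ := b₀) hmp hmm hmpm hGT₁ hGT₂ hGF₁ hGF₂
  have hGTpos : 0 < GT := lt_of_lt_of_le (mul_pos (Real.exp_pos _) hmp) hGT₁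
  have hGF0 : 0 ≤ GF := le_trans (mul_nonneg (Real.exp_pos _).le hmm) hGF₁
  have hS : 0 < GT + GF := by linarith
  have hεp : ε ≤ Real.exp (-2 * B') * ν.real Tp :=
    hε.trans (mul_le_mul_of_nonneg_left (min_le_left _ _) (Real.exp_pos _).le)
  have hεm : ε ≤ Real.exp (-2 * B') * ν.real Tm :=
    hε.trans (mul_le_mul_of_nonneg_left (min_le_right _ _) (Real.exp_pos _).le)
  have hr1 : ε ≤ GT / (GT + GF) := hεp.trans h1
  have hr2 : GT / (GT + GF) ≤ 1 - ε := h2.trans (by linarith)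
  rw [hunion]
  rw [le_div_iff₀ hS] at hr1
  rw [div_le_iff₀ hS] at hr2
  exact ⟨by linarith, hr2⟩

/-- **The fibre atom bound from small mixed differences** (see the module docstring).  The first
hypothesis is the fibre anti-concentration theorem in monotone form (stub `stub_fiberAtomMonotone`),
literally; the second the weighted antichain bound (stub `stub_antichainWeight`) at the floor `ε`. -/
theorem spreadR3_fiber_atom_le :
    (∀ {I T : Type} [Fintype I] [DecidableEq I] [MeasurableSpace T]
      (ν : Measure T) [IsProbabilityMeasure ν] {Tp Tm : Set T},
      MeasurableSet Tp → MeasurableSet Tm → Disjoint Tp Tm → ν Tp ≠ 0 →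
      ∀ {ε C : ℝ},
      (∀ (N : ℕ) (p : Fin N → ℝ), (∀ i, ε ≤ p i ∧ p i ≤ 1 - ε) →
        ∀ 𝒜 : Finset (Fin N → Bool), (∀ s ∈ 𝒜, ∀ s' ∈ 𝒜, (∀ i, s i ≤ s' i) → s = s') →
          ∑ s ∈ 𝒜, ∏ i, (if s i then p i else 1 - p i) ≤ C / Real.sqrt (N + 1)) →
      ∀ {φ : (I → T) → ℝ}, Measurable φ → ∀ {a τ B : ℝ} {b : I → T → ℝ},
      (∀ i, Measurable (b i)) →
      (∀ t : I → T, (∀ i, t i ∈ Tp ∪ Tm) → |φ t - a - ∑ i, b i (t i)| ≤ τ) →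
      (∀ i u u', u ∈ Tp ∪ Tm → u' ∈ Tp ∪ Tm → b i u ≤ b i u' + B) →
      (∀ i, ε * ∫ u in Tp ∪ Tm, Real.exp (b i u) ∂ν ≤ ∫ u in Tp, Real.exp (b i u) ∂ν ∧
        ∫ u in Tp, Real.exp (b i u) ∂ν ≤ (1 - ε) * ∫ u in Tp ∪ Tm, Real.exp (b i u) ∂ν) →
      ∀ {X : (I → T) → ℤ}, Measurable X → ∀ (S' : Finset I),
      (∀ t : I → T, (∀ i, t i ∈ Tp ∪ Tm) → ∀ i ∈ S', ∀ u ∈ Tp, t i ∈ Tm →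
        X t + 1 ≤ X (Function.update t i u)) →
      ∀ (j : ℤ),
      ∫⁻ t, (Set.pi Set.univ fun _ : I => Tp ∪ Tm).indicator
          (fun t => if X t = j then ENNReal.ofReal (Real.exp (φ t)) else 0) t
          ∂Measure.pi (fun _ : I => ν) ≤
        ENNReal.ofReal (Real.exp (2 * τ) * C / Real.sqrt (S'.card + 1)) *
          ∫⁻ t, (Set.pi Set.univ fun _ : I => Tp ∪ Tm).indicator
            (fun t => ENNReal.ofReal (Real.exp (φ t))) t ∂Measure.pi (fun _ : I => ν)) →
    ∀ {I T : Type} [Fintype I] [DecidableEq I] [MeasurableSpace T]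
      (ν : Measure T) [IsProbabilityMeasure ν] {Tp Tm : Set T},
      MeasurableSet Tp → MeasurableSet Tm → Disjoint Tp Tm → ν Tp ≠ 0 →
      ∀ {ε C : ℝ},
      (∀ (N : ℕ) (p : Fin N → ℝ), (∀ i, ε ≤ p i ∧ p i ≤ 1 - ε) →
        ∀ 𝒜 : Finset (Fin N → Bool), (∀ s ∈ 𝒜, ∀ s' ∈ 𝒜, (∀ i, s i ≤ s' i) → s = s') →
          ∑ s ∈ 𝒜, ∏ i, (if s i then p i else 1 - p i) ≤ C / Real.sqrt (N + 1)) →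
      ∀ {φ : (I → T) → ℝ}, Measurable φ → ∀ {γ B' : ℝ}, 0 ≤ γ →
      (∀ (s : I → T) (i i' : I), i ≠ i' → ∀ (u v : T),
        |φ (Function.update (Function.update s i u) i' v) - φ (Function.update s i u)
          - φ (Function.update s i' v) + φ s| ≤ γ) →
      (∀ (s : I → T) (i : I) (u u' : T), φ (Function.update s i u) ≤ φ (Function.update s i u') + B') →
      ε ≤ Real.exp (-2 * B') * min (ν Tp).toReal (ν Tm).toReal →
      ∀ {X : (I → T) → ℤ}, Measurable X →
      (∀ t : I → T, (∀ i, t i ∈ Tp ∪ Tm) → ∀ i, ∀ u ∈ Tp, t i ∈ Tm →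
        X t + 1 ≤ X (Function.update t i u)) →
      ∀ (j : ℤ),
      ∫⁻ t, (Set.pi Set.univ fun _ : I => Tp ∪ Tm).indicator
          (fun t => if X t = j then ENNReal.ofReal (Real.exp (φ t)) else 0) t
          ∂Measure.pi (fun _ : I => ν) ≤
        ENNReal.ofReal (Real.exp (2 * ((Fintype.card I : ℝ) ^ 2 * γ)) * C /
            Real.sqrt (Fintype.card I + 1)) *
          ∫⁻ t, (Set.pi Set.univ fun _ : I => Tp ∪ Tm).indicator
            (fun t => ENNReal.ofReal (Real.exp (φ t))) t ∂Measure.pi (fun _ : I => ν) := by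
  intro hFAM I T _ _ _ ν _ Tp Tm hTp hTm hdisj hTp0 ε C hAC φ hφm γ B' hγ0 hmix hosc hε X hXm hmono j
  obtain ⟨u₀, hu₀⟩ : Tp.Nonempty := nonempty_of_measure_ne_zero hTp0
  -- the product approximation: base point, one-coordinate tilts, error
  set t₀ : I → T := fun _ => u₀ with ht₀
  set b : I → T → ℝ := fun i u => φ (Function.update t₀ i u) - φ t₀ with hb_def
  have hbm : ∀ i, Measurable (b i) := fun i =>
    (hφm.comp (measurable_update t₀)).sub measurable_const
  have hadd : ∀ t : I → T, (∀ i, t i ∈ Tp ∪ Tm) →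
      |φ t - φ t₀ - ∑ i, b i (t i)| ≤ (Fintype.card I : ℝ) ^ 2 * γ := fun t _ =>
    spread_telescope_abs_le φ hγ0 hmix t₀ t
  have hb : ∀ i u u', u ∈ Tp ∪ Tm → u' ∈ Tp ∪ Tm → b i u ≤ b i u' + B' := fun i u u' _ _ => by
    simp only [hb_def]
    linarith [hosc t₀ i u u']
  have hodds : ∀ i, ε * ∫ u in Tp ∪ Tm, Real.exp (b i u) ∂ν ≤ ∫ u in Tp, Real.exp (b i u) ∂ν ∧
      ∫ u in Tp, Real.exp (b i u) ∂ν ≤ (1 - ε) * ∫ u in Tp ∪ Tm, Real.exp (b i u) ∂ν := fun i =>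
    spreadR3_odds_of_osc ν hTp hTm hdisj hTp0 (hbm i) (fun u u' => by
      simp only [hb_def]; linarith [hosc t₀ i u u']) hε
  have key := hFAM ν hTp hTm hdisj hTp0 hAC hφm hbm hadd hb hodds hXm Finset.univ
    (fun t ht i _ u hu hti => hmono t ht i u hu hti) j
  rw [Finset.card_univ] at key
  exact key

end Summit.QuantumFields.QCD.Cruxes.WindowExtinction.FreeVolumeHeavyWitness

end
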